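/-
Origin: expansion seat `planner-pub-hodgecm-mc-axioms-1-g14-0`, handover #W235 2026-08-20T15:53:55Z md5 238a0983dd98 (PKG 1836ccf31d9f → 238a0983dd98; 348 l.; MECHANICAL (iib-R) rewrite v3.1 of the PKG file as it stands (42 token edits; rules R1x1+RX[h₂]x41)) (`HOME/mc/pub-hodgecm-mc-axioms-1-g14/revendor/kit-r55/stage55/HodgeCM/Model/Binders/Gen12SeesawOfArchSide.lean`, md5 238a0983dd98, 348 lines);
landed by the gen-22 packager (p-g22) in gate run 55 REPLACES the earlier landed copy of `HodgeCM/Model/Binders/Gen12SeesawOfArchSide.lean` (seat copy carried the packager Origin header of an earlier run (stripped)).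
-/
/-
Origin: speedrun cell pub-hodgecm, MODEL-CONSTRUCTION sub-cell, unit pub-hodgecm-mc-binder-1-g9 (BINDER PROVER, gen 9; node B2-meet,
BINDER-OWNERS row 14 `gen12`, junction (x-S) CONSUMED), seat prover-pub-hodgecm-mc-binder-1-g9-0, 2026-08-19.
Target in PKG: HodgeCM/Model/Binders/Gen12SeesawOfArchSide.lean (NEW additive leaf, RUN 37+; imports kit #12 `Binders/Gen12WedgeKType`
(RUN 36), kit #8 `Binders/Real34Seesaw` (RUN 36) and period-1's S pin term `Model/ArchSideOf` (RUN-37 row #1099, after #1098 `ArchSideTerm`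
and the K-1 twins of the six GelbartRogawski1991 see-saw files); nothing landed imports it).  KERNEL ONLY: 0 records of published theorems,
nothing cited, 0 `def … : Prop`, MODEL-N ±0, E unchanged.  model1 PATH ✓ in advance (2026-08-19T19:07:24Z, STATUS l.11696).
-/
import Summits.HodgeConjecture.HodgeCM.Model.Binders.Gen12WedgeKType
import Summits.HodgeConjecture.HodgeCM.Model.Binders.Real34Seesaw
import Summits.HodgeConjecture.HodgeCM.Model.ArchSideOf_2
import Summits.HodgeConjecture.HodgeCM.Model.WmInstanceV2KType

/-!
# Row `gen12`, junction (x-S) CONSUMED: RECORD 2′ `SeesawCore` (and `SeesawHyp34`) at the HONEST pins `W := wmInputCM₂ …`, `S := archSideOf …`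

Kit #11 `SeesawCore.ofOp τ prod op wedge_mem` / kit #12 `SeesawCore.ofKType gK χ τ prod op hSK m hdet hA hB` ask the (S-restr) producer for

* `τ : 𝒮(Fin 3) →ₗ 𝒮(Fin 3) →ₗ 𝒮((W V c).ι)` bilinear,
* `prod : Θ_W (τ φ₁ φ₂) = Θ₃ φ₁ · Θ₃ φ₂`,
* `op : (W V c).ρ ((W V c).eV g, (W V c).eW (jT₁₂ t)) (τ φ₁ φ₂) = τ (((S V c).P 0).ω (g, t₁) φ₁) (((S V c).P 1).ω (g, t₂) φ₂)`.

period-1 (RUN-37 rows #1098 `Model/ArchSideTerm`, #1099 `Model/ArchSideOf`) delivers exactly these at the honest pins: `τ := ArchSideTerm.tau12 V c.D`,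
`prod := ArchSideTerm.prod_tau12 V c.D`, and `ArchSideTerm.op_archSideOf` — the operator identity at the level of the tree's
`cmPairRepTwist … hGR η (cmFrameEquiv … g, cmAdelicEquiv … (jT₁₂ t))`, i.e. LITERALLY `(W V c).ρ ((W V c).eV g, (W V c).eW (jT₁₂ t))` for
unitary-1's W pin `W V c := wmInputCM₂ V c.D hGR hρ η hη hηc hδ τ∞ T hT` (`wmInputCM₂_ρ`: `ρ = (cmPairRepTwist … hGR η).toHomUnits`,
`eV = cmFrameEquiv`, `eW = cmAdelicEquiv 2 (diagonal (dW c.D))`, `F = L⁺`, `ι = Fin 6`, all `rfl`), PROVIDED the S pin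
`S V c := archSideOf V c hGR hGR₀ hGR₁ hGR₂ hGR₃ η hη hηc h₁W A` is built on the SAME splitting `hGR` and the SAME twist character `η`
as the W pin (this sharing IS the see-saw: one Weil representation of `U(V) × U(W)` restricted two ways).

This leaf records the junction, kernel-checked (imports also unitary-1's `Model/WmInstanceV2KType`, RUN 36, for `archIsotropyRegime`):

§1 (context level, any `η`) `op_wmInputCM₂_archSideOf`, `seesaw34_wmInputCM₂_archSideOf`, `op34_wmInputCM₂_archSideOf` — the three
   period-1 junction theorems read through the PROJECTIONS of the explicit W-pin record (`exact`, definitional unfolding only);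
§2 (E's currency: pin FAMILIES over all `(V, c)`, namespace `Gen12Pins`) the honest W / S families `Gen12Pins.W …` / `Gen12Pins.S …`
   (reducible abbreviations of the two lambda families — every pin input quantified `∀ {L} {ι₁} (V) (c)`, so any coarser dependence
   instantiates them by `fun V c => …`; read-backs `W_apply` / `S_apply`, `rfl`), and AT THESE FAMILIES:
   * `Gen12Pins.hSK_archKappa` — (x-W) `hSK` of kit #12 VERBATIM along `K_∞` (`Kι := archIsotropy (τ V c) (T V c)`,
     `gK := archIsotropyRegime V hV …` (unitary-1), `χ := archKappa`), proved directly from the tree lemma `mem_cmKTypeTwist_iff`;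
   * `SeesawCore.ofArchSideOp adm wedge_mem` — RECORD 2′ with (SS) DISCHARGED, (SS-K) `wedge_mem` kept (kit #11 shape);
   * `SeesawCore.ofArchSide adm gK χ hSK m hdet hA hB` — RECORD 2′ from the (x-W)/(x-Θ)/(K-norm) junction inputs ONLY, along an
     arbitrary family `gK` (kit #12 shape);
   * `SeesawCore.ofArchSideKInfty adm m hdet hA hB` — the same along `K_∞` with (x-W) DISCHARGED (`hSK_archKappa`): remaining inputs =
     the matrices `m` with `hdet : det (m k) = archKappa k` and kit #12's `hA`/`hB` ALONG `archIsotropyRegime`;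
   * `SeesawHyp34.ofArchSide` — the (34) see-saw record of kit #8, BOTH clauses discharged (`τ := tau34`, `seesaw34_archSideOf`);
     `SeesawHyp34.ofArchSide_τ` (rfl) and `Gen12Pins.op34_W_S` (operator form for lines 2,3).
ROW 14 LEDGER after this leaf: `gen12` ⟸ (x-Θ)/(K-norm) ALONG `K_∞`: `m`, `hdet`, `hA`, `hB` of `SeesawCore.ofArchSideKInfty` = kit #18's
`hA_of_strict`/`hB_of_strict`/`det_m_of_strict` (along `gK k := ιinf (uOf k) · aOf k`, `m k := Jac (uOf k) x₀`, `χ = isotropyDetChar ∘ uOf`)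
after the INDEX JUNCTION `archIsotropyRegime V hV τ T hT k = (S V c).ιinf (uOf k) * aOf k` with `aOf k ∈ KΓ Γ`, `archKappa k = isotropyDetChar (uOf k)`
[unitary-1's `K_∞`/`archKappa` ↔ #1099 `archSideOf_ιinf_apply` / #V5] ⊕ (N1)₀,₁ ⊕ RECORD 1 `Gen12Residual` [(Θ-sat) pin + D-1′ `proj`]
— (x-S) is no longer a hypothesis.  Nothing here is a claim of the manuscripts under adjudication.
-/

set_option autoImplicit false

noncomputable section

open MeasureTheory NumberField
open scoped Matrix

namespace HodgeCM.Model

open HodgeCM HodgeCM.Universe HodgeCM.Adelic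
open Literature.NumberTheory.Weil1964
open Literature.NumberTheory.Automorphic (piSchwartzBruhat)
open Literature.NumberTheory.GelbartRogawski1991.UnitaryDualPair
open Literature.RepresentationTheory.HeisenbergGroup
open Literature.AlgebraicGeometry.HodgeTheory
open Literature.NumberTheory.Automorphic.PicardCM
open HodgeCM.Model.ThetaSpace
open HodgeCM.Model.ArchSideTerm

/-! ## 1. The three junction identities at the context `(V, c)`, read through the W-pin record's projections -/

section Context

variable {L : CMField} {ι₁ : L →+* ℂ} (V : HermSpace3 L ι₁) (c : SeesawCtx L)

local notation3 "L⁺" => maximalRealSubfield (L : Type)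

variable
  (hGR : (cmSplittingDatum (L : Type) finProdFinEquiv (frameD V) (frameD_real V) (frameD_ne V) (dW c.D) (dW_real c.D)
    (dW_ne c.D)).CompatibleSplitting)
  (hρ : HasThetaMajorants fun (p : CMAdelic (L : Type) (frameD V) × CMAdelic (L : Type) (dW c.D)) (Φ : CMSchwartz (L : Type) 6) =>
      adelicMpCont.omega (↥(maximalRealSubfield L)) (Fin 6)
        (CMGram (L : Type) finProdFinEquiv (frameD V) (frameD_real V) (dW c.D) (dW_real c.D))
        (cmPairSplitting (L : Type) finProdFinEquiv (frameD V) (frameD_real V) (frameD_ne V) (dW c.D) (dW_real c.D) (dW_ne c.D) hGR p) Φ)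
  (η : CMAdelic (L : Type) (frameD V) × CMAdelic (L : Type) (dW c.D) →* ℂˣ)
  (hη : ∀ γU ∈ CMRat (L : Type) (frameD V), ∀ γ ∈ CMRat (L : Type) (dW c.D), η (γU, γ) = 1)
  (hηc : Continuous fun p => ((η p : ℂˣ) : ℂ))
  (hδ : 0 < (ι₁ (imagUnit L)).im) (τ : L →+* ℂ) (T : GL (Fin 3) ℂ)
  (hT : Literature.NumberTheory.Automorphic.formCongr (starRingEnd ℂ) T (V.Hm.map τ) = Literature.Geometry.ComplexHyperbolic.BallModel.J)
  (hGR₀ : (cmSplittingDatum (L : Type) (e₁) (frameD V) (frameD_real V) (frameD_ne V) (lineVec (L : Type) (dW c.D 0))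
    (fun _ => dW_real c.D 0) (fun _ => dW_ne c.D 0)).CompatibleSplitting)
  (hGR₁ : (cmSplittingDatum (L : Type) (e₁) (frameD V) (frameD_real V) (frameD_ne V) (lineVec (L : Type) (dW c.D 1))
    (fun _ => dW_real c.D 1) (fun _ => dW_ne c.D 1)).CompatibleSplitting)
  (hGR₂ : (cmSplittingDatum (L : Type) (e₁) (frameD V) (frameD_real V) (frameD_ne V) (lineVec (L : Type) (dW' c.D 0))
    (fun _ => dW'_real c.D 0) (fun _ => dW'_ne c.D 0)).CompatibleSplitting)
  (hGR₃ : (cmSplittingDatum (L : Type) (e₁) (frameD V) (frameD_real V) (frameD_ne V) (lineVec (L : Type) (dW' c.D 1))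
    (fun _ => dW'_real c.D 1) (fun _ => dW'_ne c.D 1)).CompatibleSplitting)
  (h₁W : (∀ j, 0 < (ι₁ (dW c.D j)).re) ∨ ∀ j, (ι₁ (dW c.D j)).re < 0)
  (A : ∀ k : Fin 4, ArchLineInput V (lineRepD V c.D hGR hGR₀ hGR₁ hGR₂ hGR₃ η k))

/-- **(x-S) `op` at the pins** (lines `0,1`): kit #11's operator-level restriction hypothesis, VERBATIM for
`W V c := wmInputCM₂ V c.D hGR hρ η hη hηc hδ τ T hT` and `S V c := archSideOf V c hGR hGR₀ hGR₁ hGR₂ hGR₃ η hη hηc h₁W A`, with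
`τ := tau12 V c.D` — period-1's `op_archSideOf` read through the record projections `ρ`, `eV`, `eW`, `F`, `ι` (definitional). -/
theorem op_wmInputCM₂_archSideOf (g : ↥(Adelic.regimeSubgroup L V.Hm)) (t : SeesawTorus L⁺ L) (φ₁ φ₂ : piSchwartzBruhat L⁺ (Fin 3)) :
    (((wmInputCM₂ V c.D hGR hρ η hη hηc hδ τ T hT).ρ
        ((wmInputCM₂ V c.D hGR hρ η hη hηc hδ τ T hT).eV (g : ↥(Adelic.adelicUnitaryGroup L V.Hm)),
          (wmInputCM₂ V c.D hGR hρ η hη hηc hδ τ T hT).eW (c.D.jT₁₂ t))) :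
        Module.End ℂ (piSchwartzBruhat (wmInputCM₂ V c.D hGR hρ η hη hηc hδ τ T hT).F
          (wmInputCM₂ V c.D hGR hρ η hη hηc hδ τ T hT).ι)) (tau12 V c.D φ₁ φ₂) =
      tau12 V c.D (((archSideOf V c hGR hGR₀ hGR₁ hGR₂ hGR₃ η hη hηc h₁W A).P 0).ω (g, SeesawTorus.fst L⁺ L t) φ₁)
        (((archSideOf V c hGR hGR₀ hGR₁ hGR₂ hGR₃ η hη hηc h₁W A).P 1).ω (g, SeesawTorus.snd L⁺ L t) φ₂) :=
  op_archSideOf V c hGR hGR₀ hGR₁ hGR₂ hGR₃ η hη hηc h₁W A g t φ₁ φ₂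

/-- **(SS₃₄) at the pins** (lines `2,3`, Θ-value level): kit #8's `SeesawHyp34.seesaw` with `τ := tau34 V c.D` — period-1's
`seesaw34_archSideOf` read through the record projections. -/
theorem seesaw34_wmInputCM₂_archSideOf (g : ↥(Adelic.regimeSubgroup L V.Hm)) (t : SeesawTorus L⁺ L)
    (φ₂ φ₃ : piSchwartzBruhat L⁺ (Fin 3)) :
    thetaDistLM (wmInputCM₂ V c.D hGR hρ η hη hηc hδ τ T hT).F (wmInputCM₂ V c.D hGR hρ η hη hηc hδ τ T hT).ι
        ((((wmInputCM₂ V c.D hGR hρ η hη hηc hδ τ T hT).ρ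
            ((wmInputCM₂ V c.D hGR hρ η hη hηc hδ τ T hT).eV (g : ↥(Adelic.adelicUnitaryGroup L V.Hm)),
              (wmInputCM₂ V c.D hGR hρ η hη hηc hδ τ T hT).eW (c.D.jT₃₄ t))) :
            Module.End ℂ (piSchwartzBruhat (wmInputCM₂ V c.D hGR hρ η hη hηc hδ τ T hT).F
              (wmInputCM₂ V c.D hGR hρ η hη hηc hδ τ T hT).ι)) (tau34 V c.D φ₂ φ₃)) =
      thetaDistLM L⁺ (Fin 3) (((archSideOf V c hGR hGR₀ hGR₁ hGR₂ hGR₃ η hη hηc h₁W A).P 2).ω (g, SeesawTorus.fst L⁺ L t) φ₂) *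
        thetaDistLM L⁺ (Fin 3) (((archSideOf V c hGR hGR₀ hGR₁ hGR₂ hGR₃ η hη hηc h₁W A).P 3).ω (g, SeesawTorus.snd L⁺ L t) φ₃) :=
  seesaw34_archSideOf V c hGR hGR₀ hGR₁ hGR₂ hGR₃ η hη hηc h₁W A g t φ₂ φ₃

/-- **(x-S)₃₄ `op` at the pins** (lines `2,3`, operator level): period-1's `op34_archSideOf` read through the record projections. -/
theorem op34_wmInputCM₂_archSideOf (g : ↥(Adelic.regimeSubgroup L V.Hm)) (t : SeesawTorus L⁺ L)
    (φ₂ φ₃ : piSchwartzBruhat L⁺ (Fin 3)) :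
    (((wmInputCM₂ V c.D hGR hρ η hη hηc hδ τ T hT).ρ
        ((wmInputCM₂ V c.D hGR hρ η hη hηc hδ τ T hT).eV (g : ↥(Adelic.adelicUnitaryGroup L V.Hm)),
          (wmInputCM₂ V c.D hGR hρ η hη hηc hδ τ T hT).eW (c.D.jT₃₄ t))) :
        Module.End ℂ (piSchwartzBruhat (wmInputCM₂ V c.D hGR hρ η hη hηc hδ τ T hT).F
          (wmInputCM₂ V c.D hGR hρ η hη hηc hδ τ T hT).ι)) (tau34 V c.D φ₂ φ₃) =
      tau34 V c.D (((archSideOf V c hGR hGR₀ hGR₁ hGR₂ hGR₃ η hη hηc h₁W A).P 2).ω (g, SeesawTorus.fst L⁺ L t) φ₂)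
        (((archSideOf V c hGR hGR₀ hGR₁ hGR₂ hGR₃ η hη hηc h₁W A).P 3).ω (g, SeesawTorus.snd L⁺ L t) φ₃) :=
  op34_archSideOf V c hGR hGR₀ hGR₁ hGR₂ hGR₃ η hη hηc h₁W A g t φ₂ φ₃

end Context

/-! ## 2. E's currency: the honest pin FAMILIES and RECORD 2′ / the (34) record at the pins -/

namespace Gen12Pins

/-! ### the pin inputs as families over all contexts `(V, c)` (every input quantified `∀ {L} {ι₁} (V) (c)`) -/

variable
  (hGR : ∀ {L : CMField} {ι₁ : L →+* ℂ} (V : HermSpace3 L ι₁) (c : SeesawCtx L),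
    (cmSplittingDatum (L : Type) finProdFinEquiv (frameD V) (frameD_real V) (frameD_ne V) (dW c.D) (dW_real c.D)
      (dW_ne c.D)).CompatibleSplitting)
  (hρ : ∀ {L : CMField} {ι₁ : L →+* ℂ} (V : HermSpace3 L ι₁) (c : SeesawCtx L),
    HasThetaMajorants fun (p : CMAdelic (L : Type) (frameD V) × CMAdelic (L : Type) (dW c.D)) (Φ : CMSchwartz (L : Type) 6) =>
      adelicMpCont.omega (↥(maximalRealSubfield L)) (Fin 6)
        (CMGram (L : Type) finProdFinEquiv (frameD V) (frameD_real V) (dW c.D) (dW_real c.D))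
        (cmPairSplitting (L : Type) finProdFinEquiv (frameD V) (frameD_real V) (frameD_ne V) (dW c.D) (dW_real c.D) (dW_ne c.D)
          (hGR V c) p) Φ)
  (η : ∀ {L : CMField} {ι₁ : L →+* ℂ} (V : HermSpace3 L ι₁) (c : SeesawCtx L),
    CMAdelic (L : Type) (frameD V) × CMAdelic (L : Type) (dW c.D) →* ℂˣ)
  (hη : ∀ {L : CMField} {ι₁ : L →+* ℂ} (V : HermSpace3 L ι₁) (c : SeesawCtx L),
    ∀ γU ∈ CMRat (L : Type) (frameD V), ∀ γ ∈ CMRat (L : Type) (dW c.D), η V c (γU, γ) = 1)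
  (hηc : ∀ {L : CMField} {ι₁ : L →+* ℂ} (V : HermSpace3 L ι₁) (c : SeesawCtx L), Continuous fun p => ((η V c p : ℂˣ) : ℂ))
  (hδ : ∀ {L : CMField} {ι₁ : L →+* ℂ} (_V : HermSpace3 L ι₁) (_c : SeesawCtx L), 0 < (ι₁ (imagUnit L)).im)
  (τ : ∀ {L : CMField} {ι₁ : L →+* ℂ} (_V : HermSpace3 L ι₁) (_c : SeesawCtx L), L →+* ℂ)
  (T : ∀ {L : CMField} {ι₁ : L →+* ℂ} (_V : HermSpace3 L ι₁) (_c : SeesawCtx L), GL (Fin 3) ℂ)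
  (hT : ∀ {L : CMField} {ι₁ : L →+* ℂ} (V : HermSpace3 L ι₁) (c : SeesawCtx L),
    Literature.NumberTheory.Automorphic.formCongr (starRingEnd ℂ) (T V c) (V.Hm.map (τ V c)) = Literature.Geometry.ComplexHyperbolic.BallModel.J)
  (hGR₀ : ∀ {L : CMField} {ι₁ : L →+* ℂ} (V : HermSpace3 L ι₁) (c : SeesawCtx L),
    (cmSplittingDatum (L : Type) (e₁) (frameD V) (frameD_real V) (frameD_ne V) (lineVec (L : Type) (dW c.D 0))
      (fun _ => dW_real c.D 0) (fun _ => dW_ne c.D 0)).CompatibleSplitting)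
  (hGR₁ : ∀ {L : CMField} {ι₁ : L →+* ℂ} (V : HermSpace3 L ι₁) (c : SeesawCtx L),
    (cmSplittingDatum (L : Type) (e₁) (frameD V) (frameD_real V) (frameD_ne V) (lineVec (L : Type) (dW c.D 1))
      (fun _ => dW_real c.D 1) (fun _ => dW_ne c.D 1)).CompatibleSplitting)
  (hGR₂ : ∀ {L : CMField} {ι₁ : L →+* ℂ} (V : HermSpace3 L ι₁) (c : SeesawCtx L),
    (cmSplittingDatum (L : Type) (e₁) (frameD V) (frameD_real V) (frameD_ne V) (lineVec (L : Type) (dW' c.D 0))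
      (fun _ => dW'_real c.D 0) (fun _ => dW'_ne c.D 0)).CompatibleSplitting)
  (hGR₃ : ∀ {L : CMField} {ι₁ : L →+* ℂ} (V : HermSpace3 L ι₁) (c : SeesawCtx L),
    (cmSplittingDatum (L : Type) (e₁) (frameD V) (frameD_real V) (frameD_ne V) (lineVec (L : Type) (dW' c.D 1))
      (fun _ => dW'_real c.D 1) (fun _ => dW'_ne c.D 1)).CompatibleSplitting)
  (h₁W : ∀ {L : CMField} {ι₁ : L →+* ℂ} (_V : HermSpace3 L ι₁) (c : SeesawCtx L),
    (∀ j, 0 < (ι₁ (dW c.D j)).re) ∨ ∀ j, (ι₁ (dW c.D j)).re < 0)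
  (A : ∀ {L : CMField} {ι₁ : L →+* ℂ} (V : HermSpace3 L ι₁) (c : SeesawCtx L) (k : Fin 4),
    ArchLineInput V (lineRepD V c.D (hGR V c) (hGR₀ V c) (hGR₁ V c) (hGR₂ V c) (hGR₃ V c) (η V c) k))

/-- **the honest W-pin FAMILY** `(V, c) ↦ wmInputCM₂ V c.D …` (unitary-1 `Model/WmInstanceV2` §V2, generic twist character `η`;
the block of record `wmInputCM₂b` / `wmInputCM₂s'` are its instances `η := cmDetTwistChar … (charOfUnitaryLineChar χV) (charOfUnitaryLineChar χW)`,
`hρ := hasThetaMajorants_cmPairSplitting_of_signs_two …`, by `rfl`).  Reducible, so that E's own lambda family unifies with it syntactically. -/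
abbrev W : ∀ {L : CMField} {ι₁ : L →+* ℂ} (V : HermSpace3 L ι₁) (c : SeesawCtx L), WmInput V c.D :=
  fun V c => wmInputCM₂ V c.D (hGR V c) (hρ V c) (η V c) (hη V c) (hηc V c) (hδ V c) (τ V c) (T V c) (hT V c)

/-- **the honest S-pin FAMILY** `(V, c) ↦ archSideOf V c …` (period-1 `Model/ArchSideOf`, RUN-37 row #1099), on the SAME `hGR`, `η` as `W`. -/
abbrev S : ∀ {L : CMField} {ι₁ : L →+* ℂ} (V : HermSpace3 L ι₁) (c : SeesawCtx L), ThetaAdelicSide V c :=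
  fun V c => archSideOf V c (hGR V c) (hGR₀ V c) (hGR₁ V c) (hGR₂ V c) (hGR₃ V c) (η V c) (hη V c) (hηc V c) (h₁W V c) (A V c)

/-! ELABORATION NOTE (measured in this lineage's farm, Lean 4.32): apply `W` / `S` to family variables as `@hGR`, `@η`, … .  Writing
`W hGR …` makes the elaborator eta-expand each family over its implicit binders (`fun {L} {ι₁} => @hGR L ι₁`), and unifying the
resulting record `W … V c` with the explicit `wmInputCM₂ V c.D (hGR V c) …` then times out at `whnf` (200000 heartbeats), whereas with
the `@`-spelling `W @hGR … V c = wmInputCM₂ V c.D (hGR V c) …` is `rfl` in 0.4 s.  Independently (unitary-1's lesson, `WmInstanceV2KType`):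
never transport a statement from one W-record TERM to another; read every junction theorem through PROJECTIONS against value-level tree
statements — which is how every field below is proved (directly from period-1's `cmPairRepTwist`-level theorems, not from § 1). -/

variable (hHD : exists_isReal_hodgeModel) (hI : hodgePQ_independent_of_hodgeModel)
  (h₁ : BallQuotientUniformised)  (h₃ : CMAbelianVarietyRealised)
variable {L : CMField} {ι₁ : L →+* ℂ} (V : HermSpace3 L ι₁) (c : SeesawCtx L) (hV : IsAnisotropic L V.Hm)

local notation3 "L⁺" => maximalRealSubfield (L : Type)

/-- read-back: the W family at `(V, c)` IS unitary-1's record (definitional; `@`-spelling, see the note above). -/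
theorem W_apply : W @hGR @hρ @η @hη @hηc @hδ @τ @T @hT V c =
    wmInputCM₂ V c.D (hGR V c) (hρ V c) (η V c) (hη V c) (hηc V c) (hδ V c) (τ V c) (T V c) (hT V c) := rfl

/-- read-back: the S family at `(V, c)` IS period-1's pin term (definitional). -/
theorem S_apply : S @hGR @η @hη @hηc @hGR₀ @hGR₁ @hGR₂ @hGR₃ @h₁W @A V c =
    archSideOf V c (hGR V c) (hGR₀ V c) (hGR₁ V c) (hGR₂ V c) (hGR₃ V c) (η V c) (hη V c) (hηc V c) (h₁W V c) (A V c) := rfl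

/-- **(x-W) at the W family** — kit #12's `hSK` VERBATIM at `W V c := Gen12Pins.W … V c`, `Kι := K_∞ = archIsotropy (τ V c) (T V c)`,
`gK := archIsotropyRegime V hV (τ V c) (T V c) (hT V c)` (unitary-1), `χ := archKappa`: proved DIRECTLY from the tree lemma
`mem_cmKTypeTwist_iff` (as unitary-1's `wmInputCM₂_hSK`, re-derived at this record per their consumer note). -/
theorem hSK_archKappa :
    ∀ Ψ : piSchwartzBruhat (W @hGR @hρ @η @hη @hηc @hδ @τ @T @hT V c).F (W @hGR @hρ @η @hη @hηc @hδ @τ @T @hT V c).ι,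
      (∀ k : ↥(Literature.NumberTheory.Automorphic.UnitaryGroup.archIsotropy (L : Type) V.Hm (τ V c) (T V c) (hT V c)),
        (((W @hGR @hρ @η @hη @hηc @hδ @τ @T @hT V c).ρ
            ((W @hGR @hρ @η @hη @hηc @hδ @τ @T @hT V c).eV
              (archIsotropyRegime V hV (τ V c) (T V c) (hT V c) k : ↥(Adelic.adelicUnitaryGroup L V.Hm)), 1)) :
            Module.End ℂ (piSchwartzBruhat (W @hGR @hρ @η @hη @hηc @hδ @τ @T @hT V c).F (W @hGR @hρ @η @hη @hηc @hδ @τ @T @hT V c).ι)) Ψ =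
          ((Literature.NumberTheory.Automorphic.UnitaryGroup.archKappa (L : Type) V.Hm (τ V c) (T V c) (hT V c) k : ℂˣ) : ℂ) • Ψ) →
      Ψ ∈ (W @hGR @hρ @η @hη @hηc @hδ @τ @T @hT V c).SK :=
  fun Ψ h =>
    (mem_cmKTypeTwist_iff (L : Type) finProdFinEquiv (frameD V) (frameD_real V) (frameD_ne V) (dW c.D) (dW_real c.D) (dW_ne c.D)
      (hGR V c) (η V c) V.Hm (frameG V) (frame_congr V) (τ V c) (T V c) (hT V c)
      (Literature.NumberTheory.Automorphic.UnitaryGroup.archKappa (L : Type) V.Hm (τ V c) (T V c) (hT V c)) Ψ).2 h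

/- the ADMISSIBILITY predicate on `K`-type situations at the S pin (`Gen12Residual.Adm`; (Θ-sat): saturated ∧ strict).  Spelled out
(kit #7 GOTCHA: no local notation inside `variable` binders). -/
variable (adm : ∀ (Γ : Level V) (k : Fin 4),
    KTypeSituation ((pinX hHD hI h₁ h₃ (S @hGR @η @hη @hηc @hGR₀ @hGR₁ @hGR₂ @hGR₃ @h₁W @A) V c hV).P k) ((pinX hHD hI h₁ h₃ (S @hGR @η @hη @hηc @hGR₀ @hGR₁ @hGR₂ @hGR₃ @h₁W @A) V c hV).ιinf Γ) ((pinX hHD hI h₁ h₃ (S @hGR @η @hη @hηc @hGR₀ @hGR₁ @hGR₂ @hGR₃ @h₁W @A) V c hV).Δ Γ)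
        (pinX hHD hI h₁ h₃ (S @hGR @η @hη @hηc @hGR₀ @hGR₁ @hGR₂ @hGR₃ @h₁W @A) V c hV).κ₁ (pinX hHD hI h₁ h₃ (S @hGR @η @hη @hηc @hGR₀ @hGR₁ @hGR₂ @hGR₃ @h₁W @A) V c hV).τ₁ → Prop)

/-- **RECORD 2′ at the honest pins, (SS) DISCHARGED** — kit #11 `SeesawCore.ofOp` with `τ := tau12 V c.D`, `prod := prod_tau12 V c.D`,
`op := op_archSideOf …` (period-1, read through the W-record projections); the `𝒮^κ` clause (SS-K) stays a hypothesis (kit #11's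
shape, at these pins). -/
def _root_.HodgeCM.Model.SeesawCore.ofArchSideOp
    (wedge_mem : ∀ (Γ : Level V)
      (Sit₀ : KTypeSituation ((pinX hHD hI h₁ h₃ (S @hGR @η @hη @hηc @hGR₀ @hGR₁ @hGR₂ @hGR₃ @h₁W @A) V c hV).P 0) ((pinX hHD hI h₁ h₃ (S @hGR @η @hη @hηc @hGR₀ @hGR₁ @hGR₂ @hGR₃ @h₁W @A) V c hV).ιinf Γ) ((pinX hHD hI h₁ h₃ (S @hGR @η @hη @hηc @hGR₀ @hGR₁ @hGR₂ @hGR₃ @h₁W @A) V c hV).Δ Γ)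
        (pinX hHD hI h₁ h₃ (S @hGR @η @hη @hηc @hGR₀ @hGR₁ @hGR₂ @hGR₃ @h₁W @A) V c hV).κ₁ (pinX hHD hI h₁ h₃ (S @hGR @η @hη @hηc @hGR₀ @hGR₁ @hGR₂ @hGR₃ @h₁W @A) V c hV).τ₁)
      (Sit₁ : KTypeSituation ((pinX hHD hI h₁ h₃ (S @hGR @η @hη @hηc @hGR₀ @hGR₁ @hGR₂ @hGR₃ @h₁W @A) V c hV).P 1) ((pinX hHD hI h₁ h₃ (S @hGR @η @hη @hηc @hGR₀ @hGR₁ @hGR₂ @hGR₃ @h₁W @A) V c hV).ιinf Γ) ((pinX hHD hI h₁ h₃ (S @hGR @η @hη @hηc @hGR₀ @hGR₁ @hGR₂ @hGR₃ @h₁W @A) V c hV).Δ Γ)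
        (pinX hHD hI h₁ h₃ (S @hGR @η @hη @hηc @hGR₀ @hGR₁ @hGR₂ @hGR₃ @h₁W @A) V c hV).κ₁ (pinX hHD hI h₁ h₃ (S @hGR @η @hη @hηc @hGR₀ @hGR₁ @hGR₂ @hGR₃ @h₁W @A) V c hV).τ₁),
      adm Γ 0 Sit₀ → adm Γ 1 Sit₁ → ∀ j₀ ∈ Sit₀.𝓙, ∀ j₁ ∈ Sit₁.𝓙,
        tau12 V c.D (j₀.1 (Sit₀.ι (LinearMap.proj 0))) (j₁.1 (Sit₁.ι (LinearMap.proj 1))) -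
          tau12 V c.D (j₀.1 (Sit₀.ι (LinearMap.proj 1))) (j₁.1 (Sit₁.ι (LinearMap.proj 0))) ∈ (W @hGR @hρ @η @hη @hηc @hδ @τ @T @hT V c).SK) :
    SeesawCore hHD hI h₁ h₃ (W @hGR @hρ @η @hη @hηc @hδ @τ @T @hT) (S @hGR @η @hη @hηc @hGR₀ @hGR₁ @hGR₂ @hGR₃ @h₁W @A) V c hV adm :=
  SeesawCore.ofOp hHD hI h₁ h₃ (W @hGR @hρ @η @hη @hηc @hδ @τ @T @hT) (S @hGR @η @hη @hηc @hGR₀ @hGR₁ @hGR₂ @hGR₃ @h₁W @A) V c hV adm (tau12 V c.D) (prod_tau12 V c.D)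
    (fun g t φ₁ φ₂ =>
      op_archSideOf V c (hGR V c) (hGR₀ V c) (hGR₁ V c) (hGR₂ V c) (hGR₃ V c) (η V c) (hη V c) (hηc V c) (h₁W V c) (A V c) g t φ₁ φ₂)
    wedge_mem

/-- **RECORD 2′ at the honest pins from the (x-W)/(x-Θ)/(K-norm) junction inputs only** — kit #12 `SeesawCore.ofKType` with the (x-S)
inputs `τ`, `prod`, `op` DISCHARGED by period-1's pin term; remaining hypotheses in kit #12's shapes at these pins, along an ARBITRARY
family `gK : Kι → G_U(𝔸)` with character `χ`: `hSK` (x-W), the matrices `m` with `hdet` (K-norm), and the test-pair transformation laws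
`hA`/`hB` ((x-Θ): kit #18 `hA_of_strict`/`hB_of_strict` at `adm := IsSaturated ∧ IsStrict`, `gK k := ιinf (uOf k) * aOf k`). -/
def _root_.HodgeCM.Model.SeesawCore.ofArchSide {Kι : Type*} (gK : Kι → ↥(Adelic.regimeSubgroup L V.Hm)) (χ : Kι → ℂ)
    (hSK : ∀ Ψ : piSchwartzBruhat (W @hGR @hρ @η @hη @hηc @hδ @τ @T @hT V c).F (W @hGR @hρ @η @hη @hηc @hδ @τ @T @hT V c).ι,
      (∀ k : Kι, (((W @hGR @hρ @η @hη @hηc @hδ @τ @T @hT V c).ρ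
          ((W @hGR @hρ @η @hη @hηc @hδ @τ @T @hT V c).eV (gK k : ↥(Adelic.adelicUnitaryGroup L V.Hm)), 1)) :
          Module.End ℂ (piSchwartzBruhat (W @hGR @hρ @η @hη @hηc @hδ @τ @T @hT V c).F (W @hGR @hρ @η @hη @hηc @hδ @τ @T @hT V c).ι)) Ψ = χ k • Ψ) →
        Ψ ∈ (W @hGR @hρ @η @hη @hηc @hδ @τ @T @hT V c).SK)
    (m : Kι → Matrix (Fin 2) (Fin 2) ℂ) (hdet : ∀ k : Kι, (m k).det = χ k)
    (hA : ∀ (Γ : Level V)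
      (Sit : KTypeSituation ((pinX hHD hI h₁ h₃ (S @hGR @η @hη @hηc @hGR₀ @hGR₁ @hGR₂ @hGR₃ @h₁W @A) V c hV).P 0) ((pinX hHD hI h₁ h₃ (S @hGR @η @hη @hηc @hGR₀ @hGR₁ @hGR₂ @hGR₃ @h₁W @A) V c hV).ιinf Γ) ((pinX hHD hI h₁ h₃ (S @hGR @η @hη @hηc @hGR₀ @hGR₁ @hGR₂ @hGR₃ @h₁W @A) V c hV).Δ Γ)
        (pinX hHD hI h₁ h₃ (S @hGR @η @hη @hηc @hGR₀ @hGR₁ @hGR₂ @hGR₃ @h₁W @A) V c hV).κ₁ (pinX hHD hI h₁ h₃ (S @hGR @η @hη @hηc @hGR₀ @hGR₁ @hGR₂ @hGR₃ @h₁W @A) V c hV).τ₁),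
      adm Γ 0 Sit → ∀ j ∈ Sit.𝓙, ∀ (k : Kι) (i : Fin 2),
        ((S @hGR @η @hη @hηc @hGR₀ @hGR₁ @hGR₂ @hGR₃ @h₁W @A V c).P 0).ω (gK k, 1) (j.1 (Sit.ι (LinearMap.proj i))) =
          ∑ l, m k l i • j.1 (Sit.ι (LinearMap.proj l)))
    (hB : ∀ (Γ : Level V)
      (Sit : KTypeSituation ((pinX hHD hI h₁ h₃ (S @hGR @η @hη @hηc @hGR₀ @hGR₁ @hGR₂ @hGR₃ @h₁W @A) V c hV).P 1) ((pinX hHD hI h₁ h₃ (S @hGR @η @hη @hηc @hGR₀ @hGR₁ @hGR₂ @hGR₃ @h₁W @A) V c hV).ιinf Γ) ((pinX hHD hI h₁ h₃ (S @hGR @η @hη @hηc @hGR₀ @hGR₁ @hGR₂ @hGR₃ @h₁W @A) V c hV).Δ Γ)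
        (pinX hHD hI h₁ h₃ (S @hGR @η @hη @hηc @hGR₀ @hGR₁ @hGR₂ @hGR₃ @h₁W @A) V c hV).κ₁ (pinX hHD hI h₁ h₃ (S @hGR @η @hη @hηc @hGR₀ @hGR₁ @hGR₂ @hGR₃ @h₁W @A) V c hV).τ₁),
      adm Γ 1 Sit → ∀ j ∈ Sit.𝓙, ∀ (k : Kι) (i : Fin 2),
        ((S @hGR @η @hη @hηc @hGR₀ @hGR₁ @hGR₂ @hGR₃ @h₁W @A V c).P 1).ω (gK k, 1) (j.1 (Sit.ι (LinearMap.proj i))) =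
          ∑ l, m k l i • j.1 (Sit.ι (LinearMap.proj l))) :
    SeesawCore hHD hI h₁ h₃ (W @hGR @hρ @η @hη @hηc @hδ @τ @T @hT) (S @hGR @η @hη @hηc @hGR₀ @hGR₁ @hGR₂ @hGR₃ @h₁W @A) V c hV adm :=
  SeesawCore.ofKType hHD hI h₁ h₃ (W @hGR @hρ @η @hη @hηc @hδ @τ @T @hT) (S @hGR @η @hη @hηc @hGR₀ @hGR₁ @hGR₂ @hGR₃ @h₁W @A) V c hV adm gK χ (tau12 V c.D) (prod_tau12 V c.D)
    (fun g t φ₁ φ₂ =>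
      op_archSideOf V c (hGR V c) (hGR₀ V c) (hGR₁ V c) (hGR₂ V c) (hGR₃ V c) (η V c) (hη V c) (hηc V c) (h₁W V c) (A V c) g t φ₁ φ₂)
    hSK m hdet hA hB

/-- **RECORD 2′ at the honest pins along `K_∞`** (unitary-1's index): `SeesawCore.ofArchSide` at `Kι := archIsotropy (τ V c) (T V c)`,
`gK := archIsotropyRegime V hV …`, `χ := archKappa …`, with (x-W) DISCHARGED by `hSK_archKappa`.  Remaining: the matrices `m` with
`hdet : det (m k) = archKappa k` and the transformation laws `hA`/`hB` ALONG `archIsotropyRegime` — i.e. kit #18's (x-Θ) exports after the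
index junction `archIsotropyRegime V hV τ T hT k = (S V c).ιinf (uOf k) * aOf k`, `archKappa k = isotropyDetChar (uOf k)` (unitary-1 ↔ #1099
`archSideOf_ιinf_apply`). -/
def _root_.HodgeCM.Model.SeesawCore.ofArchSideKInfty
    (m : ↥(Literature.NumberTheory.Automorphic.UnitaryGroup.archIsotropy (L : Type) V.Hm (τ V c) (T V c) (hT V c)) →
      Matrix (Fin 2) (Fin 2) ℂ)
    (hdet : ∀ k, (m k).det =
      ((Literature.NumberTheory.Automorphic.UnitaryGroup.archKappa (L : Type) V.Hm (τ V c) (T V c) (hT V c) k : ℂˣ) : ℂ))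
    (hA : ∀ (Γ : Level V)
      (Sit : KTypeSituation ((pinX hHD hI h₁ h₃ (S @hGR @η @hη @hηc @hGR₀ @hGR₁ @hGR₂ @hGR₃ @h₁W @A) V c hV).P 0) ((pinX hHD hI h₁ h₃ (S @hGR @η @hη @hηc @hGR₀ @hGR₁ @hGR₂ @hGR₃ @h₁W @A) V c hV).ιinf Γ) ((pinX hHD hI h₁ h₃ (S @hGR @η @hη @hηc @hGR₀ @hGR₁ @hGR₂ @hGR₃ @h₁W @A) V c hV).Δ Γ)
        (pinX hHD hI h₁ h₃ (S @hGR @η @hη @hηc @hGR₀ @hGR₁ @hGR₂ @hGR₃ @h₁W @A) V c hV).κ₁ (pinX hHD hI h₁ h₃ (S @hGR @η @hη @hηc @hGR₀ @hGR₁ @hGR₂ @hGR₃ @h₁W @A) V c hV).τ₁),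
      adm Γ 0 Sit → ∀ j ∈ Sit.𝓙, ∀ (k : ↥(Literature.NumberTheory.Automorphic.UnitaryGroup.archIsotropy (L : Type) V.Hm (τ V c) (T V c) (hT V c)))
        (i : Fin 2),
        ((S @hGR @η @hη @hηc @hGR₀ @hGR₁ @hGR₂ @hGR₃ @h₁W @A V c).P 0).ω (archIsotropyRegime V hV (τ V c) (T V c) (hT V c) k, 1) (j.1 (Sit.ι (LinearMap.proj i))) =
          ∑ l, m k l i • j.1 (Sit.ι (LinearMap.proj l)))
    (hB : ∀ (Γ : Level V)
      (Sit : KTypeSituation ((pinX hHD hI h₁ h₃ (S @hGR @η @hη @hηc @hGR₀ @hGR₁ @hGR₂ @hGR₃ @h₁W @A) V c hV).P 1) ((pinX hHD hI h₁ h₃ (S @hGR @η @hη @hηc @hGR₀ @hGR₁ @hGR₂ @hGR₃ @h₁W @A) V c hV).ιinf Γ) ((pinX hHD hI h₁ h₃ (S @hGR @η @hη @hηc @hGR₀ @hGR₁ @hGR₂ @hGR₃ @h₁W @A) V c hV).Δ Γ)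
        (pinX hHD hI h₁ h₃ (S @hGR @η @hη @hηc @hGR₀ @hGR₁ @hGR₂ @hGR₃ @h₁W @A) V c hV).κ₁ (pinX hHD hI h₁ h₃ (S @hGR @η @hη @hηc @hGR₀ @hGR₁ @hGR₂ @hGR₃ @h₁W @A) V c hV).τ₁),
      adm Γ 1 Sit → ∀ j ∈ Sit.𝓙, ∀ (k : ↥(Literature.NumberTheory.Automorphic.UnitaryGroup.archIsotropy (L : Type) V.Hm (τ V c) (T V c) (hT V c)))
        (i : Fin 2),
        ((S @hGR @η @hη @hηc @hGR₀ @hGR₁ @hGR₂ @hGR₃ @h₁W @A V c).P 1).ω (archIsotropyRegime V hV (τ V c) (T V c) (hT V c) k, 1) (j.1 (Sit.ι (LinearMap.proj i))) =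
          ∑ l, m k l i • j.1 (Sit.ι (LinearMap.proj l))) :
    SeesawCore hHD hI h₁ h₃ (W @hGR @hρ @η @hη @hηc @hδ @τ @T @hT) (S @hGR @η @hη @hηc @hGR₀ @hGR₁ @hGR₂ @hGR₃ @h₁W @A) V c hV adm :=
  SeesawCore.ofArchSide @hGR @hρ @η @hη @hηc @hδ @τ @T @hT @hGR₀ @hGR₁ @hGR₂ @hGR₃ @h₁W @A hHD hI h₁ h₃ V c hV adm
    (archIsotropyRegime V hV (τ V c) (T V c) (hT V c))
    (fun k => ((Literature.NumberTheory.Automorphic.UnitaryGroup.archKappa (L : Type) V.Hm (τ V c) (T V c) (hT V c) k : ℂˣ) : ℂ))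
    (hSK_archKappa @hGR @hρ @η @hη @hηc @hδ @τ @T @hT V c hV) m hdet hA hB

/-- **the (34) see-saw record of kit #8 at the honest pins, BOTH clauses DISCHARGED**: `τ := tau34 V c.D`,
`seesaw :=` period-1's `seesaw34_archSideOf` read through the W-record projections.  Consumed by D-6's (K34) `gen_mem_of_kType`. -/
def _root_.HodgeCM.Model.SeesawHyp34.ofArchSide : SeesawHyp34 (W @hGR @hρ @η @hη @hηc @hδ @τ @T @hT) (S @hGR @η @hη @hηc @hGR₀ @hGR₁ @hGR₂ @hGR₃ @h₁W @A) V c where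
  τ φ₂ φ₃ := tau34 V c.D φ₂ φ₃
  seesaw g t φ₂ φ₃ :=
    seesaw34_archSideOf V c (hGR V c) (hGR₀ V c) (hGR₁ V c) (hGR₂ V c) (hGR₃ V c) (η V c) (hη V c) (hηc V c) (h₁W V c) (A V c)
      g t φ₂ φ₃

/-- read-back: the pairing of `SeesawHyp34.ofArchSide` is `tau34` (definitional). -/
theorem _root_.HodgeCM.Model.SeesawHyp34.ofArchSide_τ (φ₂ φ₃ : piSchwartzBruhat L⁺ (Fin 3)) :
    (SeesawHyp34.ofArchSide @hGR @hρ @η @hη @hηc @hδ @τ @T @hT @hGR₀ @hGR₁ @hGR₂ @hGR₃ @h₁W @A V c).τ φ₂ φ₃ = tau34 V c.D φ₂ φ₃ := rfl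

/-- **(x-S)₃₄ `op` at the pins** (lines `2,3`, operator level, for a consumer that prefers operators to Θ-values): period-1's
`op34_archSideOf` read through the W-record projections. -/
theorem op34_W_S (g : ↥(Adelic.regimeSubgroup L V.Hm)) (t : SeesawTorus L⁺ L) (φ₂ φ₃ : piSchwartzBruhat L⁺ (Fin 3)) :
    (((W @hGR @hρ @η @hη @hηc @hδ @τ @T @hT V c).ρ
        ((W @hGR @hρ @η @hη @hηc @hδ @τ @T @hT V c).eV (g : ↥(Adelic.adelicUnitaryGroup L V.Hm)), (W @hGR @hρ @η @hη @hηc @hδ @τ @T @hT V c).eW (c.D.jT₃₄ t))) :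
        Module.End ℂ (piSchwartzBruhat (W @hGR @hρ @η @hη @hηc @hδ @τ @T @hT V c).F (W @hGR @hρ @η @hη @hηc @hδ @τ @T @hT V c).ι)) (tau34 V c.D φ₂ φ₃) =
      tau34 V c.D (((S @hGR @η @hη @hηc @hGR₀ @hGR₁ @hGR₂ @hGR₃ @h₁W @A V c).P 2).ω (g, SeesawTorus.fst L⁺ L t) φ₂) (((S @hGR @η @hη @hηc @hGR₀ @hGR₁ @hGR₂ @hGR₃ @h₁W @A V c).P 3).ω (g, SeesawTorus.snd L⁺ L t) φ₃) :=
  op34_archSideOf V c (hGR V c) (hGR₀ V c) (hGR₁ V c) (hGR₂ V c) (hGR₃ V c) (η V c) (hη V c) (hηc V c) (h₁W V c) (A V c) g t φ₂ φ₃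

end Gen12Pins

end HodgeCM.Model

end
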